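import Literature.MathematicalPhysics.QuantumFieldTheory.Balaban1983to89.HaarExpChartClosedSubgroup
import Literature.MathematicalPhysics.QuantumFieldTheory.Balaban1983to89.T4RadialProjectionAC
import Literature.Analysis.Calculus.ExpDifferentialEigenvalueGaps
import HarnessLib

/-!
# Lemma A on a closed subgroup `G ≤ U(N)` (1∕2): the null criterion in Helgason's canonical coordinates, the chart inverse `logG`,
# the ambient parametrisation `X ↦ V e^X`

Support module for the residual `UVNonSUNRec` of `Summit.QuantumFields.YangMills.Theses.BalabanLadder` (item stmt-QuantumFields-19356
`UVOtherGroups`, owner's R85 item 2; `--supports stmt-QuantumFields-19356`) — kernel property #2 of the `(G, r)`-averaging prescription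
(`HaarAC`), Part I(a).  Written by planner ym-novel-YangMills-othergroups g5 (candidate 3cbf0470a57448b3 §1–§2, `LAND-REQUEST-HaarAC-Federbush.md`),
landed by prover ym-osasm-p2 g6 (split at the 400-line rule; text otherwise verbatim).

The tree proves LEMMA A — «an open-set-restricted law `((Haar)|_S).map K` is absolutely continuous when an ambient matrix map `K♯`
agreeing with `K` on `S` has, at every point of `S`, a strict real derivative killing no non-zero tangent vector» — on `U(N)`
(`T4HaarUnitaryLocalDiffeo`, Cayley chart) and on `SU(N)` (`T4HaarSUNLocalDiffeo`, determinant projection).  Neither transfers to a general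
closed subgroup.  Part I proves Lemma A for EVERY closed subgroup `G ≤ U(N)` and EVERY Haar measure on it, in Helgason's canonical coordinates:
the exponential chart `expG : 𝐠 → G` of `HaarExpChartClosedSubgroup` (window `N_e = expG{‖X‖ < r}`, `μ|_{N_e} = σ₀·expG_*(det jac·dX)`,
`det jac > 0` on the window).  This file:

* §1 null criterion: `μ T = 0 ↔ ∀ V, vol({‖X‖<r} ∩ expG⁻¹(V⁻¹T)) = 0` (left invariance + the chart formula + `det jac > 0`; `←` through a
  finite cover of the compact `G` by translated windows);
* §2 a measurable chart inverse `logG = proj ∘ log` on `{‖g − 1‖ < 1}` (`logG (expG X) = X` for `‖X‖ < log 2`), the ambient parametrisation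
  `X ↦ V·e^X` with its strict derivative `paramD V X : v ↦ V·(D exp)_X v = (V e^X)·jac(X)v` (`HaarExpChartLocal.dexp_coe_eq`), `jac(X)` injective
  when `det jac(X) ≠ 0`.

Part I(b) (`…UVNonSUNRecHaarLocalDiffeo`): the local coordinate expression, the chartwise null pieces, the main theorem
`haar_restrict_map_absolutelyContinuous`.  Part II (`…UVNonSUNRecHaarAC`): the exp-mean-log fibre law for `(G, r)` and `HaarAC` of (0.4).

HONEST SCOPE.  Pure measure theory ∕ matrix calculus on compact matrix groups (Helgason 2001 Ch. I §1, Ch. II Thm. 1.7; Hall 2015 Prop. 3.24,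
Cor. 3.44–3.45); nothing printed by Bałaban is asserted; residual leg of a CONDITIONAL chain; not a gap, not Clay.
-/

noncomputable section

open NormedSpace Metric Set Filter Topology MeasureTheory
open scoped ENNReal NNReal

namespace Summit.QuantumFields.YangMills.Theorems.UVNonSUNRecHaarClosedSubgroup

open Literature.MathematicalPhysics.QuantumFieldTheory.Balaban1983to89
open HaarExpChartClosedSubgroup (chart hlie expG coe_expG continuous_expG measurable_expG exists_haar_apply_eq_expChart
  ext_iff_coe compactSpace)
open HaarExpChartLocal (jdet jdet_def measurable_jdet proj proj_apply_coe coe_proj_of_mem dexp_coe_eq)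
open B13HaarSigmaJacobian (jac)
open MatrixLog (mlog exp_mlog analyticAt_mlog)
open LogChartClosedSubgroup (star_eq_neg_of_mem_unitarySubgroupLogChart_lie)
open Literature.Analysis.Calculus.ExpDifferential (dexp hasFDerivAt_exp_dexp hasStrictFDerivAt_exp_dexp)
open T4RadialProjectionAC (measure_inter_preimage_null_of_hasStrictFDerivAt)
open scoped Matrix Matrix.Norms.L2Operator

variable {n : Type*} [Fintype n] [DecidableEq n]
variable (Gs : Subgroup (Matrix.unitaryGroup n ℂ)) (hG : IsClosed (Gs : Set (Matrix.unitaryGroup n ℂ)))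

/-! ## §1 The null criterion in the exponential chart -/

section NullCriterion

/-- `V · expG X` read in `M_N(ℂ)` is `V e^X`. [folklore] -/
theorem coe_mul_expG (V : Gs) (X : (chart Gs hG).lie) :
    (((V * expG Gs hG X : Gs) : Matrix.unitaryGroup n ℂ) : Matrix n n ℂ) =
      (((V : Gs) : Matrix.unitaryGroup n ℂ) : Matrix n n ℂ) * exp (X : Matrix n n ℂ) := rfl

/-- The chart preimage of a window-piece: `expG⁻¹(V⁻¹T ∩ N_e) ∩ {‖X‖<r} = {‖X‖<r} ∩ expG⁻¹(V⁻¹T)`. [folklore] -/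
theorem preimage_inter_window_eq {r : ℝ} (T : Set Gs) (V : Gs) :
    expG Gs hG ⁻¹' ((fun U => V * U) ⁻¹' T ∩ expG Gs hG '' ball (0 : (chart Gs hG).lie) r) ∩
        ball (0 : (chart Gs hG).lie) r =
      ball (0 : (chart Gs hG).lie) r ∩ expG Gs hG ⁻¹' ((fun U => V * U) ⁻¹' T) := by
  ext X
  simp only [mem_inter_iff, mem_preimage]
  constructor
  · rintro ⟨⟨h1, -⟩, h2⟩; exact ⟨h2, h1⟩
  · rintro ⟨h2, h1⟩; exact ⟨⟨h1, X, h2, rfl⟩, h2⟩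

variable [MeasurableSpace (chart Gs hG).lie] [BorelSpace (chart Gs hG).lie]

/-- **Null criterion, `→`**: if `T` is `μ`-null then for every `V` the chart preimage of `V⁻¹T` inside the window is `vol`-null
(left invariance, the chart formula `μ = σ₀ ∫ det jac` on sub-windows, `σ₀ ≠ 0` and `det jac > 0`). [folklore] -/
theorem vol_null_of_haar_null (μ : Measure Gs) [μ.IsMulLeftInvariant] (vol : Measure (chart Gs hG).lie) {r : ℝ} {σ₀ : ℝ≥0∞}
    (hNo : IsOpen (expG Gs hG '' ball (0 : (chart Gs hG).lie) r))
    (hjpos : ∀ X : (chart Gs hG).lie, ‖X‖ < r → 0 < jdet (hlie Gs hG) X) (hσ : σ₀ ≠ 0)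
    (hμ : ∀ S : Set Gs, MeasurableSet S → S ⊆ expG Gs hG '' ball (0 : (chart Gs hG).lie) r →
      μ S = σ₀ * ∫⁻ X in expG Gs hG ⁻¹' S ∩ ball (0 : (chart Gs hG).lie) r, ENNReal.ofReal (jdet (hlie Gs hG) X) ∂vol)
    {T : Set Gs} (hT : MeasurableSet T) (hT0 : μ T = 0) (V : Gs) :
    vol (ball (0 : (chart Gs hG).lie) r ∩ expG Gs hG ⁻¹' ((fun U => V * U) ⁻¹' T)) = 0 := by
  have hBm : MeasurableSet ((fun U => V * U) ⁻¹' T ∩ expG Gs hG '' ball (0 : (chart Gs hG).lie) r) :=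
    (measurable_const_mul V hT).inter hNo.measurableSet
  have hB0 : μ ((fun U => V * U) ⁻¹' T ∩ expG Gs hG '' ball (0 : (chart Gs hG).lie) r) = 0 :=
    measure_mono_null inter_subset_left (by rw [measure_preimage_mul]; exact hT0)
  have hAm : MeasurableSet (ball (0 : (chart Gs hG).lie) r ∩ expG Gs hG ⁻¹' ((fun U => V * U) ⁻¹' T)) :=
    measurableSet_ball.inter (measurable_expG Gs hG (measurable_const_mul V hT))
  have hI : ∫⁻ X in ball (0 : (chart Gs hG).lie) r ∩ expG Gs hG ⁻¹' ((fun U => V * U) ⁻¹' T),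
      ENNReal.ofReal (jdet (hlie Gs hG) X) ∂vol = 0 := by
    have h := hμ _ hBm inter_subset_right
    rw [hB0, preimage_inter_window_eq] at h
    exact (mul_eq_zero.1 h.symm).resolve_left hσ
  replace hI := (lintegral_eq_zero_iff (μ := vol.restrict _) (f := fun X => ENNReal.ofReal (jdet (hlie Gs hG) X))
    (measurable_jdet (hlie Gs hG)).ennreal_ofReal).1 hI
  have hae : ∀ᵐ X ∂vol, X ∈ ball (0 : (chart Gs hG).lie) r ∩ expG Gs hG ⁻¹' ((fun U => V * U) ⁻¹' T) →
      ENNReal.ofReal (jdet (hlie Gs hG) X) = (0 : (chart Gs hG).lie → ℝ≥0∞) X := (ae_restrict_iff' hAm).1 hI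
  rw [measure_eq_zero_iff_ae_notMem]
  filter_upwards [hae] with X hX hXA
  have h0 := hX hXA
  simp only [Pi.zero_apply, ENNReal.ofReal_eq_zero] at h0
  exact (lt_irrefl (0 : ℝ)) ((hjpos X (mem_ball_zero_iff.1 hXA.1)).trans_le h0)

omit [MeasurableSpace (chart Gs hG).lie] [BorelSpace (chart Gs hG).lie] in
/-- A finite set of translates of the window covers the compact `G`. [folklore] -/
theorem exists_finite_cover {r : ℝ} (hr : 0 < r) (hNo : IsOpen (expG Gs hG '' ball (0 : (chart Gs hG).lie) r)) :
    ∃ t : Finset Gs, (univ : Set Gs) ⊆ ⋃ V ∈ t, (fun U => V⁻¹ * U) ⁻¹' (expG Gs hG '' ball (0 : (chart Gs hG).lie) r) := by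
  haveI : CompactSpace Gs := compactSpace Gs hG
  have hnhds : ∀ V : Gs, (fun U => V⁻¹ * U) ⁻¹' (expG Gs hG '' ball (0 : (chart Gs hG).lie) r) ∈ 𝓝 V := fun V =>
    (hNo.preimage (continuous_const_mul V⁻¹)).mem_nhds
      (show V⁻¹ * V ∈ expG Gs hG '' ball (0 : (chart Gs hG).lie) r by
        rw [inv_mul_cancel]; exact ⟨0, mem_ball_self hr, HaarExpChartClosedSubgroup.expG_zero Gs hG⟩)
  obtain ⟨t, -, ht⟩ := isCompact_univ.elim_nhds_subcover
    (fun V : Gs => (fun U => V⁻¹ * U) ⁻¹' (expG Gs hG '' ball (0 : (chart Gs hG).lie) r)) fun V _ => hnhds V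
  exact ⟨t, ht⟩

omit [BorelSpace (chart Gs hG).lie] in
/-- **Null criterion, `←`**: if for every `V` the chart preimage of `V⁻¹T` inside the window is `vol`-null, then `T` is `μ`-null
(finite cover by translated windows, left invariance, the chart formula). [folklore] -/
theorem haar_null_of_forall_vol_null (μ : Measure Gs) [μ.IsMulLeftInvariant] (vol : Measure (chart Gs hG).lie) {r : ℝ}
    {σ₀ : ℝ≥0∞} (hr : 0 < r) (hNo : IsOpen (expG Gs hG '' ball (0 : (chart Gs hG).lie) r))
    (hμ : ∀ S : Set Gs, MeasurableSet S → S ⊆ expG Gs hG '' ball (0 : (chart Gs hG).lie) r →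
      μ S = σ₀ * ∫⁻ X in expG Gs hG ⁻¹' S ∩ ball (0 : (chart Gs hG).lie) r, ENNReal.ofReal (jdet (hlie Gs hG) X) ∂vol)
    {T : Set Gs} (hT : MeasurableSet T)
    (h : ∀ V : Gs, vol (ball (0 : (chart Gs hG).lie) r ∩ expG Gs hG ⁻¹' ((fun U => V * U) ⁻¹' T)) = 0) :
    μ T = 0 := by
  obtain ⟨t, ht⟩ := exists_finite_cover Gs hG hr hNo
  have hTsub : T ⊆ ⋃ V ∈ t, T ∩ (fun U => V⁻¹ * U) ⁻¹' (expG Gs hG '' ball (0 : (chart Gs hG).lie) r) := by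
    intro U hU
    have hU' := ht (mem_univ U)
    simp only [mem_iUnion] at hU' ⊢
    obtain ⟨V, hV, hUV⟩ := hU'
    exact ⟨V, hV, hU, hUV⟩
  refine measure_mono_null hTsub ((measure_biUnion_null_iff t.countable_toSet).2 fun V _ => ?_)
  rw [← measure_preimage_mul μ V]
  have hset : (fun U => V * U) ⁻¹' (T ∩ (fun U => V⁻¹ * U) ⁻¹' (expG Gs hG '' ball (0 : (chart Gs hG).lie) r)) =
      (fun U => V * U) ⁻¹' T ∩ expG Gs hG '' ball (0 : (chart Gs hG).lie) r := by
    ext U; simp [inv_mul_cancel_left]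
  rw [hset, hμ _ ((measurable_const_mul V hT).inter hNo.measurableSet) inter_subset_right, preimage_inter_window_eq,
    setLIntegral_measure_zero _ _ (h V), mul_zero]

end NullCriterion

/-! ## §2 A measurable chart inverse and the ambient parametrisation `X ↦ V e^X` -/

section ChartInverse

open Classical in
/-- A measurable left inverse of `expG` on the window: `logG g = proj(log g)` on `{‖g − 1‖ < 1}`, `0` elsewhere. [folklore] -/
def logG (g : Gs) : (chart Gs hG).lie :=
  ({g : Gs | ‖(((g : Gs) : Matrix.unitaryGroup n ℂ) : Matrix n n ℂ) - 1‖ < 1} : Set Gs).piecewise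
    (fun g => proj (chart Gs hG) (mlog (((g : Gs) : Matrix.unitaryGroup n ℂ) : Matrix n n ℂ)))
    (fun _ => (0 : (chart Gs hG).lie)) g

/-- The double coercion `G → M_N(ℂ)` is continuous. [folklore] -/
theorem continuous_coe_coe : Continuous fun g : Gs => (((g : Gs) : Matrix.unitaryGroup n ℂ) : Matrix n n ℂ) :=
  continuous_subtype_val.comp continuous_subtype_val

/-- For `‖X‖ < log 2`, `‖e^X − 1‖ < 1`. [folklore] -/
theorem norm_exp_sub_one_lt_one {X : Matrix n n ℂ} (hX : ‖X‖ < Real.log 2) : ‖exp X - 1‖ < 1 := by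
  have h1 := Literature.Analysis.Calculus.norm_exp_sub_one_le X
  have h2 : Real.exp ‖X‖ < 2 := by
    calc Real.exp ‖X‖ < Real.exp (Real.log 2) := Real.exp_lt_exp.2 hX
      _ = 2 := Real.exp_log two_pos
  linarith

/-- `logG (expG X) = X` for `‖X‖ < log 2`. [folklore] -/
theorem logG_expG {X : (chart Gs hG).lie} (hX : ‖X‖ < Real.log 2) : logG Gs hG (expG Gs hG X) = X := by
  have hX' : ‖(X : Matrix n n ℂ)‖ < Real.log 2 := hX
  have hmem : expG Gs hG X ∈ {g : Gs | ‖(((g : Gs) : Matrix.unitaryGroup n ℂ) : Matrix n n ℂ) - 1‖ < 1} := by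
    show ‖(((expG Gs hG X : Gs) : Matrix.unitaryGroup n ℂ) : Matrix n n ℂ) - 1‖ < 1
    rw [coe_expG]; exact norm_exp_sub_one_lt_one hX'
  unfold logG
  rw [piecewise_eq_of_mem _ _ _ hmem, coe_expG, B7BlockAvgLog.mlog_exp hX', proj_apply_coe]

/-- `logG` is measurable (continuous on the open set `{‖g − 1‖ < 1}`, constant off it). [folklore] -/
theorem measurable_logG [MeasurableSpace (chart Gs hG).lie] [BorelSpace (chart Gs hG).lie] : Measurable (logG Gs hG) := by
  classical
  have hs : IsOpen {g : Gs | ‖(((g : Gs) : Matrix.unitaryGroup n ℂ) : Matrix n n ℂ) - 1‖ < 1} :=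
    isOpen_lt ((continuous_coe_coe Gs).sub continuous_const).norm continuous_const
  have hf : ContinuousOn (fun g : Gs => proj (chart Gs hG) (mlog (((g : Gs) : Matrix.unitaryGroup n ℂ) : Matrix n n ℂ)))
      {g : Gs | ‖(((g : Gs) : Matrix.unitaryGroup n ℂ) : Matrix n n ℂ) - 1‖ < 1} := fun g hg =>
    ((proj (chart Gs hG)).continuous.continuousAt.comp
      ((analyticAt_mlog hg).continuousAt.comp_of_eq (continuous_coe_coe Gs).continuousAt rfl)).continuousWithinAt
  have h : Measurable (({g : Gs | ‖(((g : Gs) : Matrix.unitaryGroup n ℂ) : Matrix n n ℂ) - 1‖ < 1} : Set Gs).piecewise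
      (fun g => proj (chart Gs hG) (mlog (((g : Gs) : Matrix.unitaryGroup n ℂ) : Matrix n n ℂ)))
      (fun _ => (0 : (chart Gs hG).lie))) :=
    ContinuousOn.measurable_piecewise hf continuousOn_const hs.measurableSet
  exact h

variable {Gs hG} in
/-- Elements of `𝐠` are skew-Hermitian. [cite: Hall2015, Proposition 3.24] -/
theorem conjTranspose_coe_lie (Y : (chart Gs hG).lie) : (Y : Matrix n n ℂ)ᴴ = -(Y : Matrix n n ℂ) := by
  rw [← Matrix.star_eq_conjTranspose]
  exact star_eq_neg_of_mem_unitarySubgroupLogChart_lie Gs hG Y.2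

/-- The strict derivative of the ambient parametrisation `X ↦ V e^X` of `V · N_e` at `X`: `v ↦ V · (D exp)_X(v)`. [folklore] -/
def paramD (V : Gs) (X : (chart Gs hG).lie) : (chart Gs hG).lie →L[ℝ] Matrix n n ℂ :=
  (((V : Gs) : Matrix.unitaryGroup n ℂ) : Matrix n n ℂ) •
    (((dexp ℂ (X : Matrix n n ℂ)).restrictScalars ℝ).comp (chart Gs hG).lie.subtypeL)

/-- `paramD V X v = V · (D exp)_X v`. [folklore] -/
theorem paramD_apply (V : Gs) (X v : (chart Gs hG).lie) :
    paramD Gs hG V X v = (((V : Gs) : Matrix.unitaryGroup n ℂ) : Matrix n n ℂ) * dexp ℂ (X : Matrix n n ℂ) (v : Matrix n n ℂ) := by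
  simp [paramD]

/-- `X ↦ V e^X` has strict derivative `paramD V X` at `X`. [folklore] -/
theorem hasStrictFDerivAt_param (V : Gs) (X : (chart Gs hG).lie) :
    HasStrictFDerivAt (fun X' : (chart Gs hG).lie => (((V : Gs) : Matrix.unitaryGroup n ℂ) : Matrix n n ℂ) * exp (X' : Matrix n n ℂ))
      (paramD Gs hG V X) X := by
  have h : HasStrictFDerivAt (fun X' : (chart Gs hG).lie => exp (X' : Matrix n n ℂ))
      (((dexp ℂ (X : Matrix n n ℂ)).restrictScalars ℝ).comp (chart Gs hG).lie.subtypeL) X :=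
    ((hasStrictFDerivAt_exp_dexp (X : Matrix n n ℂ)).restrictScalars ℝ).comp X (chart Gs hG).lie.subtypeL.hasStrictFDerivAt
  exact h.const_mul _

/-- `X ↦ V e^X` is continuous. [folklore] -/
theorem continuous_param (V : Gs) :
    Continuous fun X' : (chart Gs hG).lie => (((V : Gs) : Matrix.unitaryGroup n ℂ) : Matrix n n ℂ) * exp (X' : Matrix n n ℂ) :=
  continuous_iff_continuousAt.2 fun X => (hasStrictFDerivAt_param Gs hG V X).continuousAt

/-- **The tangent formula**: `V · (D exp)_X v = (V e^X) · jac(X) v` with `jac(X) v ∈ 𝐠` ([DS] II Thm. 1.7 on `𝐠`,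
`HaarExpChartLocal.dexp_coe_eq`). [cite: Helgason2000, Ch. I §1 Thm. 1.14 (12) p. 96] -/
theorem paramD_apply_eq_mul_jac (V : Gs) (X v : (chart Gs hG).lie) :
    paramD Gs hG V X v = (((V * expG Gs hG X : Gs) : Matrix.unitaryGroup n ℂ) : Matrix n n ℂ) *
      ((jac (𝕂 := ℝ) (hlie Gs hG) X v : (chart Gs hG).lie) : Matrix n n ℂ) := by
  have h1 : (dexp ℂ (X : Matrix n n ℂ)).restrictScalars ℝ = dexp ℝ (X : Matrix n n ℂ) :=
    ((hasFDerivAt_exp_dexp (𝕂 := ℂ) (X : Matrix n n ℂ)).restrictScalars ℝ).unique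
      (hasFDerivAt_exp_dexp (𝕂 := ℝ) (X : Matrix n n ℂ))
  have h2 : dexp ℂ (X : Matrix n n ℂ) (v : Matrix n n ℂ) = dexp ℝ (X : Matrix n n ℂ) (v : Matrix n n ℂ) := by
    rw [← h1]; rfl
  rw [paramD_apply, h2, dexp_coe_eq (chart Gs hG) (hlie Gs hG) X v, coe_mul_expG, mul_assoc]

/-- `jac(X)` is injective when `det jac(X) ≠ 0`. [folklore] -/
theorem jac_eq_zero_imp {X : (chart Gs hG).lie} (hdet : jdet (hlie Gs hG) X ≠ 0) {v : (chart Gs hG).lie}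
    (hv : jac (𝕂 := ℝ) (hlie Gs hG) X v = 0) : v = 0 := by
  rw [jdet_def] at hdet
  exact (LinearMap.equivOfDetNeZero _ hdet).map_eq_zero_iff.1 hv

end ChartInverse

end Summit.QuantumFields.YangMills.Theorems.UVNonSUNRecHaarClosedSubgroup

end
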